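import Literature.MathematicalPhysics.QuantumFieldTheory.Balaban1983to89.B5Eq117TorusBridge
import Literature.MathematicalPhysics.QuantumFieldTheory.Balaban1983to89.B5Eq119GaussianV1

/-!
# `Balaban1983to89.B5Eq119TorusBridge` — T. Bałaban, *Propagators and renormalization transformations for lattice gauge
theories. I*, Commun. Math. Phys. **95** (1984) 17–40 [Balaban1984PropagatorsI], (1.19) p. 20: «((ST)^k e^{−S})(B) = Z_{k,Ax} exp(−½⟨B, Δ_kB⟩)»
— the two formalizations of `Z_{k,Ax}` and `Δ_k` in the tree are ONE object: seat p38's V1 `B5Eq119GaussianV1.zAx P k`/`DeltaK P k`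
(for `rtPow k`, the `k`-fold composition of the declaration of record (1.12)) versus the B5 owner's tower `B5Eq114Gauss.Zk`/`DeltaK L M k`
(for `rt17 k`), through the (1.17) bridge `B5Eq117TorusBridge`

statement-level skeleton of published theorems with citation tags; proofs where landed; nothing here is a claim about the Yang–Mills mass gap

PDF held: `paper:balaban1984-cmp95-propagators-rt-i` (journal page = PDF page + 16); p. 20 [PDF 4] read from the materialised text
`~/.lit/texts/paper-balaban1984-cmp95-propagators-rt-i/p0004.txt`.

PRINT, verbatim (p. 20): *"This integral is also Gaussian. We define ((ST)^k e^{−S})(B) = Z_{k,Ax} exp(−½⟨B, Δ_kB⟩). (1.19)  It is easily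
seen that Z_{k,Ax} = Z^{(k−1)}·…·Z^{(0)}."*

CITATION HEADER (lean-in-tree rule) — WHAT IS REPRODUCED.  SKELETON row `B5.Eq1.19` (fold owner r02: «proved p245722 (∀k `eq119_holds`, explicit
Δ_k, d ≥ 2) · V1 twin proved p248789 (`B5Eq119GaussianV1.eq119`) · IF2-25 meet p249024 (p21 `cplx_DeltaK`: Δ_k^{(1.19)} = β `DelK`)») and
`B5.Eq1.17` (bridge p251841 + this seat's `B5Eq117TorusBridge`): KNITTING of the two PROVED (1.19)'s over `k` levels (the unit step `k = 1`
with the unit action is `B5Eq114TorusBridge`).  For the η-lattice action `S^η = ½Σ_p η^d|(∂^{L^k}A)(p)|²` (V1 `curlAction (η^d) (L^k)` = tower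
`actionEta k`, `B5Eq117TorusCarriers.actionEta_tV`):
* V1 (p38): `rtPow k e^{−S^η} B = zAx P k (η^d) (L^k) · exp(−½ B⬝(DeltaK P k (η^d) (L^k))B)` (`B5Eq119GaussianV1.eq119`), `Δ_k = W_kᵀW_k` a real
  symmetric matrix on `PBond P k`, `Z_{k,Ax} = ((ST)^k e^{−S})(0) > 0` for every `d`;
* tower (r02): `rt17 L M k B = Zk L M k · exp(−S1 M (DeltaK L M k) B)` (`B5Eq114Gauss.rt17_gauss`), `DeltaK = W_k^†W_k` symmetric.
WHAT IS PROVED (kernel, no `sorry`, standard axioms; `k ≤ m + K`, every `d ≥ 1`, odd `L > 1`):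
* `gauss_bridge` / `zAx_eq_const_mul_Zk` — `Z_{k,Ax}^{V1} = c · Z_k^{tower}` with ONE `c > 0` (product of p38's `z^{(k)}` of `eq117_curlAction`
  and the slice Jacobian of `B5Eq117TorusBridge.multiRT_eq_const_mul_rt17`); whence `Zk_pos_all_d : 0 < B5Eq114Gauss.Zk L (Mk P k) k` for
  EVERY `d ≥ 1` (the tower file has `Zk_pos` for `d ≥ 2`);
* `dotProduct_DeltaK_eq_inner_DeltaK` — the two quadratic forms `⟨B, Δ_kB⟩` AGREE: `B ⬝ᵥ (DeltaK P k (η^d) (L^k) *ᵥ B) = ⟪tB B, DeltaK L Mk k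
  (tB B)⟫`;
* `torusZax_eq_const_mul_gauss` — [BalabanImbrieJaffe1985] (4.1.4) `Z_{k,Ax}(B)` (p09) `= c·Z_k·exp(−½⟪tB B, Δ_k tB B⟫)`;
* `tB_DeltaK_mulVec` — **the two operators `Δ_k` AGREE**: `tB (DeltaK P k (η^d) (L^k) *ᵥ B) = B5Eq114Gauss.DeltaK L (Mk P k) k (tB B)`
  (polarization of the two symmetric forms + `⟪tB x, tB y⟫ = x ⬝ᵥ y`).
HONEST SCOPE.  The η-lattice action only (weight `η^d = L^{−kd}`, factor `L^k` — the objects `Zk`/`DeltaK`/`rt17` of the tower file are typed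
for `S^η`); the constant `c` is existential (slice Jacobian × `z^{(k)}`), not evaluated.  Theorems only; no new definitions, no `def … : Prop`.

Unit `lit-balaban-p16` gen 3 (Phase-2 proof seat p16; literature-prover-lit-balaban-p16-g3-0), HOME `run/shared/lean/pub/lit-balaban/`
(STATUS: `lit-balaban-p16/STATUS.md`), 2026-08-21.
-/

open scoped BigOperators Matrix RealInnerProductSpace

namespace Literature.MathematicalPhysics.QuantumFieldTheory.Balaban1983to89

namespace B5Eq119TorusBridge

open LatticeFieldCalculus B5SectBStatements B5Eq117TorusCarriers B5Eq117TorusBridge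
open B5Prop11Plancherel (Tor fine)
open B5Eq117CompositionV1 (rtPow multiRT eq117_curlAction)
open B5Eq119GaussianV1 (zAx zAx_pos DeltaK_isSymm)
open B5Eq114Gauss (Zk rt17_gauss DeltaK_symm)

noncomputable section

variable {P : Params} {k : ℕ}

/-! ## §1  The two Gaussians (1.19) through the (1.17) bridge -/

/-- the inner products of transported unit-lattice fields are the dot products: `⟪tB x, tB y⟫ = x ⬝ᵥ y`.
[cite: Balaban1984PropagatorsI, (1.19) p.20] -/
theorem inner_tB (x y : VecField P k ℝ) : ⟪tB (P := P) (k := k) x, tB y⟫ = x ⬝ᵥ y := by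
  rw [PiLp.inner_apply, dotProduct]
  exact Fintype.sum_equiv (bondEquiv (P := P) (j := k)) _ _ fun i => by
    simp only [tB_apply, RCLike.inner_apply, conj_trivial, bondEquiv, Equiv.coe_fn_mk, mul_comm]

/-- `η^d > 0` and `L^k ≠ 0` (the parameters of the η-lattice action). [cite: Balaban1984PropagatorsI, (1.17) p.20] -/
theorem eta_pow_pos (P : Params) (k : ℕ) : 0 < eta P.L k ^ P.d := by
  unfold eta
  exact pow_pos (inv_pos.2 (pow_pos (Nat.cast_pos.2 P.L_pos) k)) _

/-- **(1.19) BRIDGED**: with ONE constant `c > 0`, for every unit-lattice field `B`,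
`Z_{k,Ax}·exp(−½ B⬝Δ_k^{V1}B) = c·Z_k·exp(−½⟪tB B, Δ_k^{tower} tB B⟫)` — p38's `eq119` and r02's `rt17_gauss` are the two sides of
`B5Eq117TorusBridge.multiRT_eq_const_mul_rt17` (and p38's `eq117_curlAction`). [cite: Balaban1984PropagatorsI, (1.19) p.20] -/
theorem gauss_bridge (hk : k ≤ P.m + P.K) :
    ∃ c : ℝ, 0 < c ∧ ∀ B : VecField P k ℝ,
      zAx P k (eta P.L k ^ P.d) ((P.L : ℝ) ^ k)
          * Real.exp (-(1 / 2) * (B ⬝ᵥ (B5Eq119GaussianV1.DeltaK P k (eta P.L k ^ P.d) ((P.L : ℝ) ^ k) *ᵥ B)))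
        = c * (Zk P.L (Mk P k) k * Real.exp (-S1 (Mk P k) (B5Eq114Gauss.DeltaK P.L (Mk P k) k) (tB B))) := by
  have hc : ((P.L : ℝ) ^ k) ≠ 0 := pow_ne_zero _ (Nat.cast_pos.2 P.L_pos).ne'
  obtain ⟨z, hz, hz'⟩ := eq117_curlAction (P := P) hk (eta_pow_pos P k) hc
  obtain ⟨c, hcpos, h⟩ := multiRT_eq_const_mul_rt17 (P := P) (k := k) hk
  refine ⟨z * c, mul_pos hz hcpos, fun B => ?_⟩
  rw [← B5Eq119GaussianV1.eq119 hk (eta_pow_pos P k) hc B, ← rt17_gauss, hz' B, h B, mul_assoc]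

/-- **`Z_{k,Ax}^{V1} = c·Z_k^{tower}`** (the bridged (1.19) at `B = 0`). [cite: Balaban1984PropagatorsI, (1.19) p.20] -/
theorem zAx_eq_const_mul_Zk (hk : k ≤ P.m + P.K) :
    ∃ c : ℝ, 0 < c ∧ zAx P k (eta P.L k ^ P.d) ((P.L : ℝ) ^ k) = c * Zk P.L (Mk P k) k ∧ ∀ B : VecField P k ℝ,
      zAx P k (eta P.L k ^ P.d) ((P.L : ℝ) ^ k)
          * Real.exp (-(1 / 2) * (B ⬝ᵥ (B5Eq119GaussianV1.DeltaK P k (eta P.L k ^ P.d) ((P.L : ℝ) ^ k) *ᵥ B)))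
        = c * (Zk P.L (Mk P k) k * Real.exp (-S1 (Mk P k) (B5Eq114Gauss.DeltaK P.L (Mk P k) k) (tB B))) := by
  obtain ⟨c, hc, h⟩ := gauss_bridge (P := P) (k := k) hk
  refine ⟨c, hc, ?_, h⟩
  have h0 := h 0
  simp only [map_zero, S1, inner_zero_left, mul_zero, Matrix.mulVec_zero, dotProduct_zero, neg_zero,
    Real.exp_zero, mul_one] at h0
  exact h0

/-- **`Z_k > 0` on the tower for EVERY `d ≥ 1`** (inherited from p38's V1 `zAx_pos`; the tower file's `B5Eq114Gauss.Zk_pos` covers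
`d ≥ 2`). [cite: Balaban1984PropagatorsI, (1.19) p.20] -/
theorem Zk_pos_all_d (hk : k ≤ P.m + P.K) : 0 < Zk P.L (Mk P k) k := by
  obtain ⟨c, hc, h0, -⟩ := zAx_eq_const_mul_Zk (P := P) (k := k) hk
  have hz : 0 < zAx P k (eta P.L k ^ P.d) ((P.L : ℝ) ^ k) :=
    zAx_pos (P := P) (k := k) hk (eta_pow_pos P k) (pow_ne_zero _ (Nat.cast_pos.2 P.L_pos).ne')
  rw [h0] at hz
  exact pos_of_mul_pos_right hz hc.le

/-- **the two quadratic forms `⟨B, Δ_kB⟩` of (1.19) agree**: `B ⬝ᵥ (Δ_k^{V1} B) = ⟪tB B, Δ_k^{tower}(tB B)⟫`.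
[cite: Balaban1984PropagatorsI, (1.19) p.20] -/
theorem dotProduct_DeltaK_eq_inner_DeltaK (hk : k ≤ P.m + P.K) (B : VecField P k ℝ) :
    B ⬝ᵥ (B5Eq119GaussianV1.DeltaK P k (eta P.L k ^ P.d) ((P.L : ℝ) ^ k) *ᵥ B)
      = ⟪tB (P := P) (k := k) B, B5Eq114Gauss.DeltaK P.L (Mk P k) k (tB B)⟫ := by
  obtain ⟨c, hc, h0, h⟩ := zAx_eq_const_mul_Zk (P := P) (k := k) hk
  have hZ : 0 < Zk P.L (Mk P k) k := Zk_pos_all_d (P := P) hk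
  have hB := h B
  rw [h0, mul_assoc] at hB
  have hB' := mul_left_cancel₀ hZ.ne' (mul_left_cancel₀ hc.ne' hB)
  have hexp := Real.exp_injective hB'
  simp only [S1] at hexp
  linarith

/-- **[BalabanImbrieJaffe1985] (4.1.4) `Z_{k,Ax}(B)` IS the tower Gaussian of (1.19)**: p09's `torusZax` (η-lattice action, at the V1
representative `faceFieldIter k B`) `= c · Z_k · exp(−½⟪tB B, Δ_k tB B⟫)` with ONE `c > 0` (`B5Eq117TorusBridge.torusZax_eq_const_mul_rt17`
+ r02's `rt17_gauss`). [cite: BalabanImbrieJaffe1985, (4.1.4) p.310] -/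
theorem torusZax_eq_const_mul_gauss (hk : k ≤ P.m + P.K) :
    ∃ c : ℝ, 0 < c ∧ ∀ B : VecField P k ℝ,
      Literature.MathematicalPhysics.QuantumFieldTheory.BalabanImbrieJaffe1984to88.BIJ85AxialMinimizer413.torusZax
          (eta P.L k ^ P.d) ((P.L : ℝ) ^ k) k (B5Eq117CompositionV1.faceFieldIter k B)
        = c * (Zk P.L (Mk P k) k * Real.exp (-S1 (Mk P k) (B5Eq114Gauss.DeltaK P.L (Mk P k) k) (tB B))) := by
  obtain ⟨c, hc, h⟩ := torusZax_eq_const_mul_rt17 (P := P) (k := k) hk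
  exact ⟨c, hc, fun B => by rw [h B, rt17_gauss]⟩

/-! ## §2  The two operators `Δ_k` agree (polarization) -/

/-- symmetry of the V1 form (`DeltaK_isSymm`). [cite: Balaban1984PropagatorsI, (1.19) p.20] -/
theorem dotProduct_DeltaK_comm (w c : ℝ) (x y : VecField P k ℝ) :
    x ⬝ᵥ (B5Eq119GaussianV1.DeltaK P k w c *ᵥ y) = y ⬝ᵥ (B5Eq119GaussianV1.DeltaK P k w c *ᵥ x) := by
  have hs : (B5Eq119GaussianV1.DeltaK P k w c)ᵀ = B5Eq119GaussianV1.DeltaK P k w c := DeltaK_isSymm (P := P) k w c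
  rw [Matrix.dotProduct_mulVec, ← Matrix.mulVec_transpose, hs, dotProduct_comm]

/-- **THE TWO `Δ_k` ARE ONE OPERATOR**: `tB (Δ_k^{V1} B) = Δ_k^{tower} (tB B)` — p38's matrix `B5Eq119GaussianV1.DeltaK P k (η^d) (L^k)` on
`PBond P k` and the B5 owner's `B5Eq114Gauss.DeltaK L (Mk P k) k` on `Fld (Mk P k)` (= β `DelK` by p21's `B5Eq166GaussDeltaK.cplx_DeltaK`)
are conjugate under the transport `tB`. [cite: Balaban1984PropagatorsI, (1.19) p.20] -/
theorem tB_DeltaK_mulVec (hk : k ≤ P.m + P.K) (B : VecField P k ℝ) :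
    tB (P := P) (k := k) (B5Eq119GaussianV1.DeltaK P k (eta P.L k ^ P.d) ((P.L : ℝ) ^ k) *ᵥ B)
      = B5Eq114Gauss.DeltaK P.L (Mk P k) k (tB B) := by
  have hbil : ∀ x y : VecField P k ℝ,
      x ⬝ᵥ (B5Eq119GaussianV1.DeltaK P k (eta P.L k ^ P.d) ((P.L : ℝ) ^ k) *ᵥ y)
        = ⟪tB (P := P) (k := k) x, B5Eq114Gauss.DeltaK P.L (Mk P k) k (tB y)⟫ := by
    intro x y
    have hq := dotProduct_DeltaK_eq_inner_DeltaK (P := P) hk (x + y)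
    have hx := dotProduct_DeltaK_eq_inner_DeltaK (P := P) hk x
    have hy := dotProduct_DeltaK_eq_inner_DeltaK (P := P) hk y
    rw [Matrix.mulVec_add, add_dotProduct, dotProduct_add, dotProduct_add, dotProduct_DeltaK_comm _ _ y x, map_add, map_add,
      inner_add_left, inner_add_right, inner_add_right, ← DeltaK_symm P.L (Mk P k) k (tB y) (tB x),
      real_inner_comm (tB x)] at hq
    linarith
  apply ext_inner_left ℝ
  intro v
  obtain ⟨x, rfl⟩ := (tB (P := P) (k := k)).surjective v
  rw [inner_tB, hbil]

end

end B5Eq119TorusBridge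

end Literature.MathematicalPhysics.QuantumFieldTheory.Balaban1983to89
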